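import Mathlib.Algebra.MvPolynomial.Funext
import Mathlib.LinearAlgebra.Matrix.Permanent
import Literature.LinearAlgebra.Matrix.PermanentLaplace
import Literature.Computability.AlgebraicComplexity.StandardFamilies
import Literature.Computability.AlgebraicComplexity.KIReductionInstance
import HarnessLib

/-!
# Kabanets–Impagliazzo, Cor. 12: soundness and completeness of the identity-test instance

Second file of the discharge of the reduction fact
`Literature.Computability.AlgebraicComplexity.permanent01Graph_polyExists_preimage_PIT`
(`PermanentGraphNSUBEXP.lean`), about the instance `kiCircuit n M v P` of
`KIReductionInstance.lean`.

**Part 1 — soundness** (`kiCircuit_sound`): if the instance computes the zero polynomial then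
`v = per M` — for EVERY guess `P`. Printed argument (Kabanets–Impagliazzo 2003, proof of
Lemma 11, p. 358): "By the definition of Permanent, we have that `C` is a correct circuit for
Perm of `n × n` integer matrices iff `h₁ ≡ 0` and, for each `1 < i ≤ n`, `hᵢ ≡ 0`", i.e. the
identities force `Qᵢ = per_i` level by level by Laplace expansion along the first row
(`Matrix.permanent_eq_sum_row_zero`); here the identities are read off the vanishing of a sum of
squares of integer polynomials (`eq_zero_of_add_sq_eq_zero`: evaluate at integer points and use
`MvPolynomial.funext`), and the last one, `Qₙ(M) = v`, then gives `v = per M`.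
* `genMat n m`, `genPer n m` — the top-left `m × m` block of the generic matrix in the variables
  `x_{ab} ↦ a·n + b` and its permanent; `genPer_succ` — its Laplace expansion in the exact shape
  of the level identities (`minorLayer`); `aeval_constLayer_genPer` — its value at `M`;
* `Q_eq_genPer` — under the identities, `Qᵢ = genPer i` (`i ≤ n`); `kiCircuit_sound`.

**Part 2 — completeness**: if every `per_i` has a fan-in-two constant-free circuit of size
`≤ i^c + c` (the hypothesis "`(PER_n)` has p-bounded constant-free complexity" of pnp.S39,
`constantFreeComplexity` being attained over `ℤ`, `exists_computes_size_eq_constantFreeComplexity`),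
then there is a guess `P` — gate lists of length `≤ i^c + c + 1` whose references stay inside
their own use — on which `kiCircuit n M (per M) P` computes the zero polynomial for every integer
matrix `M` (proof of Cor. 12: "If Perm is computable by polynomial-size arithmetic circuits, then
… we can nondeterministically guess" such circuits; they pass the test of Lemma 11).
* `toKOp`, `sumTwo`, `toKGate`, `toKBlock n C` — conversion of a circuit over the `i × i`
  variable matrix into a guessed gate list (variables become input positions `a·n + b`, gate
  references become block references, junk forward references become the constant `0`, the
  output is copied by a last gate `out + 0`); `blockPoly_toKBlock` — it computes
  `C.eval (x_{a·n+b})`, so `genPer n i` when `C` computes `perPoly (Fin i) ℤ`;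
* `kiCircuit_complete` — the instance vanishes when `Qᵢ = genPer i` (`i ≤ n`) and `v = per M`;
* `exists_good_blocks` — the packaged completeness statement consumed by the string level.

## References

* V. Kabanets, R. Impagliazzo, *Derandomizing polynomial identity tests means proving circuit
  lower bounds*, STOC 2003, Lemma 11 and proof of Cor. 12 (p. 358).
* H. Minc, *Permanents*, Encyclopedia Math. Appl. 6 (1978), §1.2 (Laplace expansion).
* P. Bürgisser, *Completeness and Reduction in Algebraic Complexity Theory*, Springer 2000,
  §1.4 (constant-free circuits), Def. 2.1.
-/


noncomputable section

open MvPolynomial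

namespace Literature.Computability.AlgebraicComplexity

namespace KIReduction

open ArithCircuit

variable {n : ℕ}

/-! ### Sums of squares of integer polynomials -/

/-- A polynomial all of whose integer values are non-negative. [folklore] -/
def EvalNonneg {σ : Type*} (p : MvPolynomial σ ℤ) : Prop := ∀ x : σ → ℤ, 0 ≤ eval x p

/-- `0` has non-negative values. [folklore] -/
theorem evalNonneg_zero {σ : Type*} : EvalNonneg (0 : MvPolynomial σ ℤ) := fun _ => by simp

/-- `A + e²` has non-negative values if `A` has. [folklore] -/
theorem EvalNonneg.add_sq {σ : Type*} {A : MvPolynomial σ ℤ} (h : EvalNonneg A) (e : MvPolynomial σ ℤ) :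
    EvalNonneg (A + e ^ 2) := fun x => by
  rw [map_add, map_pow]; exact add_nonneg (h x) (sq_nonneg _)

/-- **A sum of squares over `ℤ` vanishes only termwise**: if `A + e² = 0` with `A` of
non-negative values, then `e = 0` and `A = 0` (evaluate at every integer point; an integer
polynomial vanishing at all integer points is zero, `MvPolynomial.funext`). [folklore] -/
theorem eq_zero_of_add_sq_eq_zero {σ : Type*} {A e : MvPolynomial σ ℤ} (hA : EvalNonneg A)
    (h : A + e ^ 2 = 0) : e = 0 ∧ A = 0 := by
  have key : ∀ x : σ → ℤ, eval x e = 0 ∧ eval x A = 0 := fun x => by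
    have hx := congr_arg (eval x) h
    rw [map_add, map_pow, map_zero] at hx
    have h1 := hA x
    have h2 := sq_nonneg (eval x e)
    constructor
    · nlinarith [sq_nonneg (eval x e)]
    · linarith
  exact ⟨MvPolynomial.funext fun x => by rw [(key x).1, map_zero],
    MvPolynomial.funext fun x => by rw [(key x).2, map_zero]⟩

variable (n)

/-- The running sums of squares have non-negative values. [folklore] -/
theorem evalNonneg_accLevels (P : ℕ → KBlock) : ∀ i, EvalNonneg (accLevels n P i)
  | 0 => evalNonneg_zero.add_sq _
  | i + 1 => (evalNonneg_accLevels P i).add_sq _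

/-- **All identities hold when the instance vanishes.** [cite: KabanetsImpagliazzo2003, proof of Lemma 11 (p. 358)] -/
theorem identities_of_accFinal_eq_zero (M : Fin n → Fin n → ℤ) (v : ℤ) (P : ℕ → KBlock)
    (h : accFinal n M v P = 0) :
    eFinal n M v P = 0 ∧ eZero n P = 0 ∧ ∀ i, 1 ≤ i → i ≤ n → eLevel n P i = 0 := by
  obtain ⟨hF, hn⟩ := eq_zero_of_add_sq_eq_zero (evalNonneg_accLevels n P n) h
  have down : ∀ i, accLevels n P i = 0 → eZero n P = 0 ∧ ∀ i', 1 ≤ i' → i' ≤ i → eLevel n P i' = 0 := by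
    intro i
    induction i with
    | zero =>
      intro h0
      refine ⟨(eq_zero_of_add_sq_eq_zero evalNonneg_zero h0).1, fun i' h1 h2 => by omega⟩
    | succ i ih =>
      intro hs
      obtain ⟨he, hi⟩ := eq_zero_of_add_sq_eq_zero (evalNonneg_accLevels n P i) hs
      obtain ⟨hz, hall⟩ := ih hi
      refine ⟨hz, fun i' h1 h2 => ?_⟩
      rcases Nat.lt_or_ge i' (i + 1) with hlt | hge
      · exact hall i' h1 (by omega)
      · obtain rfl : i' = i + 1 := le_antisymm h2 hge
        exact he
  exact ⟨hF, down n hn⟩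

/-! ### The generic top-left blocks and their Laplace expansion -/

/-- The top-left `m × m` block of the generic `n × n` matrix, entry `(a, b)` the variable
`a·n + b` (junk `0` when out of range, i.e. never for `m ≤ n`). [cite: KabanetsImpagliazzo2003, Lemma 11 (p. 358)] -/
def genMat (m : ℕ) : Matrix (Fin m) (Fin m) (MvPolynomial (Fin (n * n)) ℤ) :=
  fun a b => (varEntry n (a.val * n + b.val)).toPoly

/-- `per` of the top-left `m × m` block of the generic matrix ("`pᵢ` computes Perm on `i × i`
matrices"). [cite: KabanetsImpagliazzo2003, Lemma 11 (p. 358)] -/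
def genPer (m : ℕ) : MvPolynomial (Fin (n * n)) ℤ := (genMat n m).permanent

variable {n}

/-- An in-range position `a·n + b`. [folklore] -/
theorem idx_lt {a b : ℕ} (ha : a < n) (hb : b < n) : a * n + b < n * n := by
  calc a * n + b < a * n + n := by omega
    _ = (a + 1) * n := by ring
    _ ≤ n * n := Nat.mul_le_mul_right _ ha

/-- Row of the position `a·n + b`. [folklore] -/
theorem idx_div {a b : ℕ} (hb : b < n) : (a * n + b) / n = a := by
  have hn : 0 < n := by omega
  rw [Nat.add_comm, Nat.add_mul_div_right _ _ hn, Nat.div_eq_of_lt hb, Nat.zero_add]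

/-- Column of the position `a·n + b`. [folklore] -/
theorem idx_mod {a b : ℕ} (hb : b < n) : (a * n + b) % n = b := by
  rw [Nat.add_comm, Nat.add_mul_mod_self_right, Nat.mod_eq_of_lt hb]

/-- `varEntry` in range is the variable. [folklore] -/
theorem toPoly_varEntry {k : ℕ} (hk : k < n * n) : (varEntry n k).toPoly = X ⟨k, hk⟩ := by
  simp [varEntry, hk, LayerEntry.toPoly]

/-- The permanent commutes with ring maps applied entrywise (re-proved one-liner; the tree's
`Matrix.permanent_map_ringHom` lives in a file with heavier imports). [folklore] -/
theorem permanent_map' {m : Type*} [DecidableEq m] [Fintype m] {R S : Type*} [CommSemiring R]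
    [CommSemiring S] (f : R →+* S) (A : Matrix m m R) : (A.map f).permanent = f A.permanent := by
  simp [Matrix.permanent, map_sum, map_prod]

/-- The value of `Fin.succAbove` (skip the hole `j`). [folklore] -/
theorem val_succAbove_eq {m : ℕ} (j : Fin (m + 1)) (b : Fin m) :
    (j.succAbove b).val = if b.val < j.val then b.val else b.val + 1 := by
  unfold Fin.succAbove
  by_cases h : b.val < j.val
  · rw [if_pos (show Fin.castSucc b < j from h), if_pos h]; rfl
  · rw [if_neg (show ¬ Fin.castSucc b < j from h), if_neg h]; rfl

/-- **The minor layer substitutes the minor**: applying the minor layer of level `m + 1`, column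
`j`, to the generic `m × m` permanent gives the permanent of the generic `(m+1) × (m+1)` block
with row `0` and column `j` deleted (`m + 1 ≤ n`). [cite: KabanetsImpagliazzo2003, Lemma 11 (p. 358)] -/
theorem aeval_minorLayer_genPer {m : ℕ} (hm : m + 1 ≤ n) (j : Fin (m + 1)) :
    aeval (fun k => (minorLayer n (m + 1) j.val k).toPoly) (genPer n m) =
      ((genMat n (m + 1)).submatrix Fin.succ j.succAbove).permanent := by
  unfold genPer
  rw [← AlgHom.coe_toRingHom, ← permanent_map']
  congr 1
  ext a b
  have ha : a.val < n := by omega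
  have hb : b.val < n := by omega
  simp only [Matrix.map_apply, Matrix.submatrix_apply, genMat, AlgHom.coe_toRingHom, Fin.val_succ,
    val_succAbove_eq]
  rw [toPoly_varEntry (idx_lt ha hb), aeval_X]
  simp only [minorLayer, idx_div hb, idx_mod hb, Nat.add_sub_cancel, a.isLt, b.isLt, and_self,
    if_true]

/-- **Laplace expansion of the generic permanent in the shape of the level identity**
(`m + 1 ≤ n`): `genPer (m+1) = Σ_{j<m+1} x_{0j} · (minor layer j applied to genPer m)`.
[cite: KabanetsImpagliazzo2003, Lemma 11 (2) (p. 358)] -/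
theorem genPer_succ {m : ℕ} (hm : m + 1 ≤ n) :
    genPer n (m + 1) = (Finset.range (m + 1)).sum fun j =>
      (varEntry n j).toPoly * aeval (fun k => (minorLayer n (m + 1) j k).toPoly) (genPer n m) := by
  rw [Finset.sum_range, genPer, Matrix.permanent_eq_sum_row_zero]
  refine Finset.sum_congr rfl fun j _ => ?_
  rw [aeval_minorLayer_genPer hm j]
  congr 1
  simp [genMat]

/-- `genPer 0 = 1`. [folklore] -/
theorem genPer_zero : genPer n 0 = 1 := by
  simp [genPer, Matrix.permanent_isEmpty]

/-- `finDiv` of the position `a·n + b` is `a`. [folklore] -/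
theorem finDiv_idx (a b : Fin n) (h : a.val * n + b.val < n * n) : finDiv ⟨a.val * n + b.val, h⟩ = a :=
  Fin.ext (idx_div b.isLt)

/-- `finMod` of the position `a·n + b` is `b`. [folklore] -/
theorem finMod_idx (a b : Fin n) (h : a.val * n + b.val < n * n) : finMod ⟨a.val * n + b.val, h⟩ = b :=
  Fin.ext (idx_mod b.isLt)

/-- **The constant layer evaluates the generic permanent at `M`.** [cite: KabanetsImpagliazzo2003, proof of Cor. 12 (p. 358)] -/
theorem aeval_constLayer_genPer (M : Fin n → Fin n → ℤ) :
    aeval (fun k => (constLayer n M k).toPoly) (genPer n n) = C (Matrix.of M).permanent := by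
  unfold genPer
  rw [← AlgHom.coe_toRingHom, ← permanent_map',
    ← permanent_map' (C : ℤ →+* MvPolynomial (Fin (n * n)) ℤ) (Matrix.of M)]
  congr 1
  ext a b
  simp only [Matrix.map_apply, genMat, AlgHom.coe_toRingHom, Matrix.of_apply]
  rw [toPoly_varEntry (idx_lt a.isLt b.isLt), aeval_X]
  simp only [constLayer, LayerEntry.toPoly, finDiv_idx, finMod_idx]

/-! ### Soundness -/

variable (n)

/-- **Under the identities, `Qᵢ = per_i` for `i ≤ n`** (induction on `i`: level `0` gives
`Q₀ = 1 = per₀`; level `i + 1` is the Laplace expansion `genPer_succ`). Kabanets–Impagliazzo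
2003, proof of Lemma 11: "if `pₙ ≡ Perm`, then each `pᵢ` computes Perm on `i × i` matrices" read
backwards. [cite: KabanetsImpagliazzo2003, proof of Lemma 11 (p. 358)] -/
theorem Q_eq_genPer (P : ℕ → KBlock) (hz : eZero n P = 0)
    (hl : ∀ i, 1 ≤ i → i ≤ n → eLevel n P i = 0) : ∀ i, i ≤ n → Q n P i = genPer n i
  | 0, _ => by
    rw [genPer_zero]
    exact sub_eq_zero.1 hz
  | i + 1, hi => by
    have ih := Q_eq_genPer P hz hl i (Nat.le_of_succ_le hi)
    have h := sub_eq_zero.1 (hl (i + 1) (Nat.succ_pos i) hi)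
    rw [h, genPer_succ hi]
    refine Finset.sum_congr rfl fun j _ => ?_
    simp only [minorTerm, Nat.add_sub_cancel, ih]

/-- **Soundness of the reduction instance.** If `kiCircuit n M v P` computes the zero polynomial
then `v = per M` — for every guessed family `P` (Kabanets–Impagliazzo 2003, Lemma 11 + proof of
Cor. 12: the identities certify the guessed circuit, which is then evaluated at `M`; here the
evaluation is the last identity). [cite: KabanetsImpagliazzo2003, Lemma 11 and proof of Cor. 12 (p. 358)] -/
theorem kiCircuit_sound (M : Fin n → Fin n → ℤ) (v : ℤ) (P : ℕ → KBlock)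
    (h : (kiCircuit n M v P).eval = 0) : v = (Matrix.of M).permanent := by
  rw [eval_kiCircuit] at h
  obtain ⟨hF, hz, hl⟩ := identities_of_accFinal_eq_zero n M v P h
  have hQ := Q_eq_genPer n P hz hl n le_rfl
  have hF' := sub_eq_zero.1 hF
  rw [hQ, aeval_constLayer_genPer] at hF'
  exact (C_injective _ _ hF').symm

/-! ## Part 2: completeness -/

variable (n : ℕ)

/-! ### Conversion of circuits into guessed gate lists -/

/-- Conversion of an operand of a circuit over the `i × i` variable matrix, at gate number `t`:
variables become input positions, references to earlier gates become block references, junk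
(forward) references become `0`, constants `1, -1` are kept and every other constant becomes `0`
(only `0` occurs in a constant-free circuit). [cite: KabanetsImpagliazzo2003, proof of Cor. 12 (p. 358)] -/
def toKOp {i : ℕ} (t : ℕ) : Operand ℤ (Fin i × Fin i) → KOp
  | .var ab => .ref (ab.1.val * n + ab.2.val)
  | .gate j => if j < t then .ref (n * n + j) else .zero
  | .const c => if c = 1 then .one else if c = -1 then .negOne else .zero

/-- The guessed gate computing `c₁ • x + c₂ • y` for sign constants `c₁, c₂`. [folklore] -/
def sumTwo (c₁ c₂ : ℤ) (x y : KOp) : KGate :=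
  if c₁ = 1 then (if c₂ = 1 then ⟨.add, x, y⟩ else if c₂ = -1 then ⟨.sub, x, y⟩ else ⟨.add, x, .zero⟩)
  else if c₁ = -1 then
    (if c₂ = 1 then ⟨.sub, y, x⟩ else if c₂ = -1 then ⟨.negAdd, x, y⟩ else ⟨.sub, .zero, x⟩)
  else (if c₂ = 1 then ⟨.add, .zero, y⟩ else if c₂ = -1 then ⟨.sub, .zero, y⟩ else ⟨.add, .zero, .zero⟩)

/-- Conversion of gate number `t` of a fan-in-two circuit (junk for larger fan-in). [cite: KabanetsImpagliazzo2003, proof of Cor. 12 (p. 358)] -/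
def toKGate {i : ℕ} (t : ℕ) : Gate ℤ (Fin i × Fin i) → KGate
  | .sum [] => ⟨.add, .zero, .zero⟩
  | .sum [(c, u)] => sumTwo c 0 (toKOp n t u) .zero
  | .sum [(c₁, u₁), (c₂, u₂)] => sumTwo c₁ c₂ (toKOp n t u₁) (toKOp n t u₂)
  | .sum (_ :: _ :: _ :: _) => ⟨.add, .zero, .zero⟩
  | .prod [] => ⟨.mul, .one, .one⟩
  | .prod [u] => ⟨.mul, toKOp n t u, .one⟩
  | .prod [u₁, u₂] => ⟨.mul, toKOp n t u₁, toKOp n t u₂⟩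
  | .prod (_ :: _ :: _ :: _) => ⟨.mul, .one, .one⟩

/-- **The guessed gate list of a circuit**: its gates converted in order, then `output + 0`. [cite: KabanetsImpagliazzo2003, proof of Cor. 12 (p. 358)] -/
def toKBlock {i : ℕ} (C : ArithCircuit ℤ (Fin i × Fin i)) : KBlock :=
  C.gates.mapIdx (toKGate n) ++ [⟨.add, toKOp n C.size C.output, .zero⟩]

/-- Length of the converted list: one more than the size. [folklore] -/
@[simp] theorem length_toKBlock {i : ℕ} (C : ArithCircuit ℤ (Fin i × Fin i)) :
    (toKBlock n C).length = C.size + 1 := by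
  simp [toKBlock, size]

/-! ### Semantics of realised guessed gates -/

variable {n}
variable {τ : Type*}

/-- The value of a realised guessed gate in terms of the values of its operands. [folklore] -/
theorem eval_toGate (base : ℕ) (g : KGate) (V : List (MvPolynomial τ ℤ)) :
    (g.toGate base : Gate ℤ τ).eval V =
      match g.kind with
      | .add => (g.a.toOperand base : Operand ℤ τ).eval V + (g.b.toOperand base : Operand ℤ τ).eval V
      | .sub => (g.a.toOperand base : Operand ℤ τ).eval V - (g.b.toOperand base : Operand ℤ τ).eval V
      | .mul => (g.a.toOperand base : Operand ℤ τ).eval V * (g.b.toOperand base : Operand ℤ τ).eval V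
      | .negAdd => -(g.a.toOperand base : Operand ℤ τ).eval V - (g.b.toOperand base : Operand ℤ τ).eval V := by
  obtain ⟨kd, a, b⟩ := g
  cases kd <;> simp [KGate.toGate, Gate.eval, sub_eq_add_neg]

/-- The constant operand `zero` evaluates to `0`. [folklore] -/
@[simp] theorem eval_toOperand_zero (base : ℕ) (V : List (MvPolynomial τ ℤ)) :
    (KOp.zero.toOperand base : Operand ℤ τ).eval V = 0 := by
  simp [KOp.toOperand, Operand.eval]

/-- The constant operand `one` evaluates to `1`. [folklore] -/
@[simp] theorem eval_toOperand_one (base : ℕ) (V : List (MvPolynomial τ ℤ)) :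
    (KOp.one.toOperand base : Operand ℤ τ).eval V = 1 := by
  simp [KOp.toOperand, Operand.eval]

/-- **`sumTwo` computes `c₁ • x + c₂ • y`** for sign constants. [folklore] -/
theorem eval_sumTwo {c₁ c₂ : ℤ} (h₁ : IsSignConstant c₁) (h₂ : IsSignConstant c₂) (x y : KOp)
    (base : ℕ) (V : List (MvPolynomial τ ℤ)) :
    ((sumTwo c₁ c₂ x y).toGate base : Gate ℤ τ).eval V =
      c₁ • (x.toOperand base : Operand ℤ τ).eval V + c₂ • (y.toOperand base : Operand ℤ τ).eval V := by
  have e₁ : c₁ = 0 ∨ c₁ = 1 ∨ c₁ = -1 := by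
    rcases h₁ with h | h | h <;> [exact Or.inl h; exact Or.inr (Or.inl h); exact Or.inr (Or.inr (by omega))]
  have e₂ : c₂ = 0 ∨ c₂ = 1 ∨ c₂ = -1 := by
    rcases h₂ with h | h | h <;> [exact Or.inl h; exact Or.inr (Or.inl h); exact Or.inr (Or.inr (by omega))]
  rcases e₁ with rfl | rfl | rfl <;> rcases e₂ with rfl | rfl | rfl <;>
    simp [sumTwo, eval_toGate, sub_eq_add_neg, add_comm]

/-! ### The converted list computes the circuit -/

/-- The substitution `X_{(a,b)} ↦ x_{a·n+b}` of the `i × i` variable matrix into the input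
positions (`i ≤ n`). [cite: KabanetsImpagliazzo2003, Lemma 11 (p. 358)] -/
def ψ {i : ℕ} (hi : i ≤ n) (ab : Fin i × Fin i) : MvPolynomial (Fin (n * n)) ℤ :=
  X ⟨ab.1.val * n + ab.2.val, idx_lt (by omega) (by omega)⟩

/-- The prefix of a use behind the identity layer: the guard and the `N` layer gates. [folklore] -/
def idPre (N : ℕ) : List (Gate ℤ (Fin N)) :=
  Gate.sum [] :: List.ofFn fun k => layerGate (idLayer N k)

/-- The use behind the identity layer is the prefix followed by the realised block. [folklore] -/
theorem useGates_idLayer_eq (N : ℕ) (B : KBlock) :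
    useGates 0 (idLayer N) B = idPre N ++ B.map (KGate.toGate 1) := by
  simp [useGates, idPre]

/-- Gate lists with value-independent gates have the obvious value list. [folklore] -/
theorem gateValues_eq_map_of_forall {σ : Type*} (gs : List (Gate ℤ σ)) (f : Gate ℤ σ → MvPolynomial σ ℤ)
    (h : ∀ g ∈ gs, ∀ vals, g.eval vals = f g) : gateValues gs = gs.map f := by
  induction gs using List.reverseRecOn with
  | nil => rfl
  | append_singleton gs g ih =>
    rw [gateValues_append_singleton, ih (fun g' hg' => h g' (by simp [hg'])), List.map_append,
      List.map_singleton, h g (by simp)]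

/-- The value list of the prefix: `0, X 0, …, X (N-1)`. [folklore] -/
theorem gateValues_idPre (N : ℕ) :
    gateValues (idPre N) = (0 : MvPolynomial (Fin N) ℤ) :: List.ofFn fun k : Fin N => X k := by
  rw [gateValues_eq_map_of_forall (idPre N)
    (fun g => g.eval []) (fun g hg vals => ?_)]
  · simp [idPre, List.map_ofFn, Function.comp_def, idLayer, LayerEntry.toPoly]
  · simp only [idPre, List.mem_cons, List.mem_ofFn] at hg
    rcases hg with rfl | ⟨k, rfl⟩
    · simp
    · simp

/-- Length of the prefix values. [folklore] -/
theorem length_gateValues_idPre (N : ℕ) : (gateValues (idPre N)).length = N + 1 := by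
  rw [gateValues_idPre]; simp

/-- Reading a layer position off the prefix values. [folklore] -/
theorem getElem?_gateValues_idPre {N k : ℕ} (hk : k < N) (ws : List (MvPolynomial (Fin N) ℤ)) :
    (gateValues (idPre N) ++ ws)[1 + k]? = some (X ⟨k, hk⟩) := by
  rw [List.getElem?_append_left (by rw [length_gateValues_idPre]; omega), gateValues_idPre,
    show 1 + k = k + 1 by omega, List.getElem?_cons_succ, List.getElem?_ofFn]
  simp [hk]

/-- **Operand lemma**: a converted operand, realised at `1` and read against the prefix values
followed by the substituted values of the first `t` gates, is the substituted value of the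
operand (sign constants; `i ≤ n`). [cite: KabanetsImpagliazzo2003, proof of Cor. 12 (p. 358)] -/
theorem eval_toKOp {i : ℕ} (hi : i ≤ n) (u : Operand ℤ (Fin i × Fin i)) (hu : u.HasSignConstants)
    (vals : List (MvPolynomial (Fin i × Fin i) ℤ)) :
    ((toKOp n vals.length u).toOperand 1 : Operand ℤ (Fin (n * n))).eval
        (gateValues (idPre (n * n)) ++ vals.map (aeval (ψ hi))) = aeval (ψ hi) (u.eval vals) := by
  cases u with
  | var ab =>
    have hk : ab.1.val * n + ab.2.val < n * n := idx_lt (by omega) (by omega)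
    simp only [toKOp, KOp.toOperand, Operand.eval, List.getD_eq_getElem?_getD]
    rw [getElem?_gateValues_idPre hk, aeval_X]
    rfl
  | const c =>
    have e : c = 0 ∨ c = 1 ∨ c = -1 := by
      rcases hu with h | h | h <;> [exact Or.inl h; exact Or.inr (Or.inl h); exact Or.inr (Or.inr (by omega))]
    rcases e with rfl | rfl | rfl <;> simp [toKOp, KOp.toOperand, Operand.eval]
  | gate j =>
    by_cases hj : j < vals.length
    · simp only [toKOp, hj, if_true, KOp.toOperand, Operand.eval, List.getD_eq_getElem?_getD]
      rw [List.getElem?_append_right (by rw [length_gateValues_idPre]; omega),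
        length_gateValues_idPre, show 1 + (n * n + j) - (n * n + 1) = j by omega,
        List.getElem?_map, List.getElem?_eq_getElem hj]
      simp
    · simp only [toKOp, hj, if_false]
      rw [eval_toOperand_zero, Operand.eval_gate, List.getD_eq_getElem?_getD,
        List.getElem?_eq_none (by omega)]
      simp

/-- **Gate lemma**: a converted fan-in-two gate with sign constants, realised at `1`, computes the
substituted value of the gate. [cite: KabanetsImpagliazzo2003, proof of Cor. 12 (p. 358)] -/
theorem eval_toKGate {i : ℕ} (hi : i ≤ n) (g : Gate ℤ (Fin i × Fin i)) (h2 : g.fanIn ≤ 2)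
    (hs : g.HasSignConstants) (vals : List (MvPolynomial (Fin i × Fin i) ℤ)) :
    ((toKGate n vals.length g).toGate 1 : Gate ℤ (Fin (n * n))).eval
        (gateValues (idPre (n * n)) ++ vals.map (aeval (ψ hi))) = aeval (ψ hi) (g.eval vals) := by
  cases g with
  | sum args =>
    match args, h2, hs with
    | [], _, _ => simp [toKGate, KGate.toGate, KOp.toOperand, Gate.eval, Operand.eval]
    | [(c, u)], _, hs =>
      have hc := (hs (c, u) (by simp)).1
      have hu := (hs (c, u) (by simp)).2
      simp only [toKGate]
      rw [eval_sumTwo hc isSignConstant_zero, eval_toKOp hi u hu]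
      simp [Gate.eval, MvPolynomial.smul_eq_C_mul]
    | [(c₁, u₁), (c₂, u₂)], _, hs =>
      have h₁ := hs (c₁, u₁) (by simp)
      have h₂ := hs (c₂, u₂) (by simp)
      simp only [toKGate]
      rw [eval_sumTwo h₁.1 h₂.1, eval_toKOp hi u₁ h₁.2, eval_toKOp hi u₂ h₂.2]
      simp [Gate.eval, MvPolynomial.smul_eq_C_mul]
    | _ :: _ :: _ :: _, h2, _ => simp [Gate.fanIn, Gate.args] at h2
  | prod args =>
    match args, h2, hs with
    | [], _, _ => simp [toKGate, KGate.toGate, KOp.toOperand, Gate.eval, Operand.eval]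
    | [u], _, hs =>
      simp only [toKGate, eval_toGate]
      rw [eval_toKOp hi u (hs u (by simp))]
      simp [Gate.eval]
    | [u₁, u₂], _, hs =>
      simp only [toKGate, eval_toGate]
      rw [eval_toKOp hi u₁ (hs u₁ (by simp)), eval_toKOp hi u₂ (hs u₂ (by simp))]
      simp [Gate.eval]
    | _ :: _ :: _ :: _, h2, _ => simp [Gate.fanIn, Gate.args] at h2

/-- **Value-list lemma**: behind the identity layer, the converted gates of a fan-in-two
constant-free circuit have the substituted value list of the circuit. [cite: KabanetsImpagliazzo2003, proof of Cor. 12 (p. 358)] -/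
theorem gateValues_idPre_append_mapIdx {i : ℕ} (hi : i ≤ n) (gs : List (Gate ℤ (Fin i × Fin i)))
    (h2 : ∀ g ∈ gs, g.fanIn ≤ 2) (hs : ∀ g ∈ gs, g.HasSignConstants) :
    gateValues (idPre (n * n) ++ (gs.mapIdx (toKGate n)).map (KGate.toGate 1)) =
      gateValues (idPre (n * n)) ++ (gateValues gs).map (aeval (ψ hi)) := by
  induction gs using List.reverseRecOn with
  | nil => simp [gateValues]
  | append_singleton gs g ih =>
    have ih' := ih (fun g' hg' => h2 g' (by simp [hg'])) (fun g' hg' => hs g' (by simp [hg']))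
    rw [List.mapIdx_concat, List.map_append, List.map_singleton, ← List.append_assoc,
      gateValues_append_singleton, ih', gateValues_append_singleton, List.map_append,
      List.map_singleton, List.append_assoc]
    have hlen : gs.length = (gateValues gs).length := (gateValues_length gs).symm
    rw [hlen, eval_toKGate hi g (h2 g (by simp)) (hs g (by simp)) (gateValues gs)]

/-- **The converted list computes the circuit at the input positions**: for a fan-in-two
constant-free circuit `C` over the `i × i` variable matrix (`i ≤ n`),
`blockPoly (n²) (toKBlock n C) = C.eval (x_{a·n+b})`. [cite: KabanetsImpagliazzo2003, proof of Cor. 12 (p. 358)] -/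
theorem blockPoly_toKBlock {i : ℕ} (hi : i ≤ n) (C : ArithCircuit ℤ (Fin i × Fin i))
    (h2 : C.IsFanInTwo) (hs : C.HasSignConstants) :
    blockPoly (n * n) (toKBlock n C) = aeval (ψ hi) C.eval := by
  unfold blockPoly
  rw [useGates_idLayer_eq, toKBlock, List.map_append, List.map_singleton, ← List.append_assoc,
    show useOut (n * n) (C.gates.mapIdx (toKGate n) ++ [(⟨.add, toKOp n C.size C.output, .zero⟩ : KGate)]) =
      (idPre (n * n) ++ (C.gates.mapIdx (toKGate n)).map (KGate.toGate 1)).length by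
        simp [useOut, idPre, size]; omega,
    valueAt_append_singleton, gateValues_idPre_append_mapIdx hi C.gates h2 hs.1, eval_toGate]
  simp only
  rw [eval_toOperand_zero, add_zero, show C.size = (gateValues C.gates).length by
    rw [gateValues_length]; rfl, eval_toKOp hi C.output hs.2]
  rfl

/-- **The converted list of a circuit for `perPoly (Fin i) ℤ` computes `genPer n i`** (`i ≤ n`). [cite: KabanetsImpagliazzo2003, proof of Cor. 12 (p. 358)] -/
theorem blockPoly_toKBlock_of_computes {i : ℕ} (hi : i ≤ n) {C : ArithCircuit ℤ (Fin i × Fin i)}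
    (h2 : C.IsFanInTwo) (hs : C.HasSignConstants) (hC : C.Computes (perPoly (Fin i) ℤ)) :
    blockPoly (n * n) (toKBlock n C) = genPer n i := by
  rw [blockPoly_toKBlock hi C h2 hs, hC, perPoly, genPer, ← AlgHom.coe_toRingHom, ← permanent_map']
  congr 1
  ext a b
  simp only [Matrix.map_apply, Matrix.mvPolynomialX_apply, AlgHom.coe_toRingHom, aeval_X, genMat]
  rw [toPoly_varEntry (idx_lt (by omega) (by omega))]
  rfl

/-! ### References of the converted lists stay inside their use -/

/-- The position referred to by an operand (`0` for constants). [folklore] -/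
def KOp.idx : KOp → ℕ
  | .ref k => k
  | _ => 0

/-- Converted operands refer below `n² + t` (`i ≤ n`). [folklore] -/
theorem idx_toKOp_lt {i : ℕ} (hi : i ≤ n) (t : ℕ) (u : Operand ℤ (Fin i × Fin i)) :
    (toKOp n t u).idx < n * n + t + 1 := by
  cases u with
  | var ab =>
    have := idx_lt (n := n) (a := ab.1.val) (b := ab.2.val) (by omega) (by omega)
    simp only [toKOp, KOp.idx]; omega
  | const c => simp only [toKOp]; split_ifs <;> simp [KOp.idx]
  | gate j =>
    simp only [toKOp]
    split_ifs with h
    · simp only [KOp.idx]; omega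
    · simp [KOp.idx]

/-- `sumTwo` only uses the given operands and `zero`. [folklore] -/
theorem idx_sumTwo_le (c₁ c₂ : ℤ) (x y : KOp) :
    (sumTwo c₁ c₂ x y).a.idx ≤ max x.idx y.idx ∧ (sumTwo c₁ c₂ x y).b.idx ≤ max x.idx y.idx := by
  unfold sumTwo
  split_ifs <;> simp [KOp.idx]

/-- Converted gates refer below `n² + t + 1` (`i ≤ n`). [folklore] -/
theorem idx_toKGate_lt {i : ℕ} (hi : i ≤ n) (t : ℕ) (g : Gate ℤ (Fin i × Fin i)) :
    (toKGate n t g).a.idx < n * n + t + 1 ∧ (toKGate n t g).b.idx < n * n + t + 1 := by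
  have hop := idx_toKOp_lt (n := n) hi t
  cases g with
  | sum args =>
    match args with
    | [] => simp [toKGate, KOp.idx]
    | [(c, u)] =>
      have h := idx_sumTwo_le c 0 (toKOp n t u) .zero
      have hu := hop u
      have hz : KOp.zero.idx = 0 := rfl
      rw [hz, Nat.max_zero] at h
      simp only [toKGate]
      omega
    | [(c₁, u₁), (c₂, u₂)] =>
      have h := idx_sumTwo_le c₁ c₂ (toKOp n t u₁) (toKOp n t u₂)
      have hu₁ := hop u₁
      have hu₂ := hop u₂
      simp only [toKGate]
      omega
    | _ :: _ :: _ :: _ => simp [toKGate, KOp.idx]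
  | prod args =>
    match args with
    | [] => simp [toKGate, KOp.idx]
    | [u] => exact ⟨by simpa [toKGate] using hop u, by simp [toKGate, KOp.idx]⟩
    | [u₁, u₂] => exact ⟨by simpa [toKGate] using hop u₁, by simpa [toKGate] using hop u₂⟩
    | _ :: _ :: _ :: _ => simp [toKGate, KOp.idx]

/-- **References of a converted list stay inside its use**: every operand refers below
`n² + |toKBlock n C|`. [folklore] -/
theorem idx_lt_of_mem_toKBlock {i : ℕ} (hi : i ≤ n) (C : ArithCircuit ℤ (Fin i × Fin i))
    {g : KGate} (hg : g ∈ toKBlock n C) :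
    g.a.idx < n * n + (toKBlock n C).length ∧ g.b.idx < n * n + (toKBlock n C).length := by
  rw [length_toKBlock]
  simp only [toKBlock, List.mem_append, List.mem_mapIdx, List.mem_singleton] at hg
  rcases hg with ⟨t, ht, rfl⟩ | rfl
  · have h := idx_toKGate_lt (n := n) hi t (C.gates[t])
    have : t < C.size := ht
    omega
  · have h := idx_toKOp_lt (n := n) hi C.size C.output
    exact ⟨show (toKOp n C.size C.output).idx < n * n + (C.size + 1) by omega,
      show KOp.zero.idx < n * n + (C.size + 1) by simp [KOp.idx]⟩

/-! ### Completeness -/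

variable (n)

/-- **The instance vanishes on a correct guess**: if `Qᵢ = genPer i` for `i ≤ n` then
`kiCircuit n M (per M) P` computes `0` (all level identities are Laplace expansions, the last one
is `per M = per M`). [cite: KabanetsImpagliazzo2003, Lemma 11 and proof of Cor. 12 (p. 358)] -/
theorem kiCircuit_complete (P : ℕ → KBlock) (hP : ∀ i, i ≤ n → Q n P i = genPer n i)
    (M : Fin n → Fin n → ℤ) : (kiCircuit n M (Matrix.of M).permanent P).eval = 0 := by
  rw [eval_kiCircuit, accFinal]
  have hacc : ∀ i, i ≤ n → accLevels n P i = 0 := by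
    intro i
    induction i with
    | zero => intro _; simp [accLevels, eZero, hP 0 (Nat.zero_le n), genPer_zero]
    | succ i ih =>
      intro hi
      rw [accLevels, ih (Nat.le_of_succ_le hi), zero_add, eLevel, hP (i + 1) hi, genPer_succ hi]
      have : (Finset.range (i + 1)).sum (minorTerm n P (i + 1)) = (Finset.range (i + 1)).sum fun j =>
          (varEntry n j).toPoly * aeval (fun k => (minorLayer n (i + 1) j k).toPoly) (genPer n i) :=
        Finset.sum_congr rfl fun j _ => by simp only [minorTerm, Nat.add_sub_cancel, hP i (by omega)]
      rw [this, sub_self, zero_pow two_ne_zero]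
  rw [hacc n le_rfl, zero_add, eFinal, hP n le_rfl, aeval_constLayer_genPer, sub_self,
    zero_pow two_ne_zero]

/-- **Completeness, packaged**: under "`τ(per_i) ≤ i^c + c` for all `i`" there is a guess `P`
with short lists (`|P i| ≤ i^c + c + 1`), references inside their uses, and
`kiCircuit n M (per M) P ≡ 0` for every integer matrix `M`. [cite: KabanetsImpagliazzo2003, proof of Cor. 12 (p. 358)] -/
theorem exists_good_blocks {c : ℕ} (hc : ∀ i, constantFreeComplexity (perPoly (Fin i) ℤ) ≤ i ^ c + c) :
    ∃ P : ℕ → KBlock,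
      (∀ i, (P i).length ≤ i ^ c + c + 1) ∧
      (∀ i, ∀ g ∈ P i, g.a.idx < n * n + (P i).length ∧ g.b.idx < n * n + (P i).length) ∧
      ∀ M : Fin n → Fin n → ℤ, (kiCircuit n M (Matrix.of M).permanent P).eval = 0 := by
  choose C hC using fun i => exists_computes_size_eq_constantFreeComplexity (perPoly (Fin i) ℤ)
  refine ⟨fun i => if i ≤ n then toKBlock n (C i) else [], fun i => ?_, fun i g hg => ?_, fun M => ?_⟩
  · show (if i ≤ n then toKBlock n (C i) else []).length ≤ i ^ c + c + 1
    split_ifs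
    · rw [length_toKBlock, (hC i).2.2.2]; exact Nat.succ_le_succ (hc i)
    · exact Nat.zero_le _
  · by_cases hi : i ≤ n
    · simp only [hi, if_true] at hg ⊢
      exact idx_lt_of_mem_toKBlock hi (C i) hg
    · simp [hi] at hg
  · refine kiCircuit_complete n _ (fun i hi => ?_) M
    simp only [Q, hi, if_true]
    exact blockPoly_toKBlock_of_computes hi (hC i).1 (hC i).2.1 (hC i).2.2.1

end KIReduction

end Literature.Computability.AlgebraicComplexity

end
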